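import Literature.MathematicalPhysics.QuantumLattice.SU2HaarChart
import Summits.QuantumFields.YangMills.Theorems.SwapTwistDeficitToronLogShell
import HarnessLib

/-!
# Zero-mode EXACT rung, building block Z1-a: the axial tube of `SU(2)` has Haar mass EXACTLY `min 1 R²` («Archimedes on `S³`»)
# (free-hands support of crux ⟨stmt-QuantumFields-24197⟩ `SwapVirialDeficit.SwapGluedStiffness`; fcl-p3 g43's zero-mode exact rung plan
# `memo-24197-zero-mode-exact-rung.md` (evidence #10 on ⟨24197⟩), item Z1; LEAD ym-line-sfw-p2 g93's «next zero-mode rung = EXACT small-ball asymptotics»)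

★★ `haar_axialTube_eq`: for `0 ≤ R`,
  `Haar{u ∈ SU(2) | (q u)_J² + (q u)_K² ≤ R²} = min 1 R²`   (`q = su2Quat`, Haar = `haarProbability`),
i.e. under Haar measure the squared distance of the unit quaternion from the `(1,i)`-plane is UNIFORM on `[0,1]` — the projection of the uniform
measure of `S³ ⊂ ℂ²` to one complex coordinate is uniform on the disc (Archimedes / Duistermaat–Heckman for the circle action).  This is the
one-letter fibre volume behind every EXACT zero-mode constant (`v₂`, `v₃`, `v₇` of the plan): file Z1-b turns it into the exact commutator ball
`Haar{u | ‖[q a, q u]‖ ≤ t} = min 1 (t²/(4(1 − re(q a)²)))` by conjugation.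
Proof (gnomonic chart ✓`lintegral_haarProbability_su2_gnomonic`: Haar = `(2π²)⁻¹[δ_{P(1,v)} + δ_{P(−1,−v)}](1+|v|²)⁻² dv`): in the chart the tube
is `v₁² + v₂² ≤ R²(1+|v|²)`, i.e. for fixed axial coordinate `v₀ = t` the planar disc `|w|² ≤ S_t = R²(1+t²)/(1−R²)`; §1–§2 compute the disc integral
`∫_{|w|²≤S} (c+|w|²)⁻² dw = π(c⁻¹ − (c+S)⁻¹)` by polar coordinates (here `= πR²/(1+t²)`), and `∫(1+t²)⁻¹dt = π` finishes: `(2π²)⁻¹·2·π²R² = R²`.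
§§1–2 follow the route of fcl-p3 g43's unfiled draft `fcl-p3-g43-ZeroModeExactAxialTube.draft.lean` (HOME of cell ym-idea-1), re-proved here.

HONEST LABEL: an exact finite-dimensional Haar-measure identity (plan-level zero-mode rung Z1 of a DRAFT line); NOT the fixed-`L` sharp law, NOT ⟨24197⟩;
no rung / summit statement is proved; the Yang–Mills mass gap is NOT proved; no summit is proved by a line.  Width seat ym-line-sfw-p2-w3 g62 (cell
ym-idea-1, free hands; own crux ⟨22884⟩ blocked-on ⟨19935⟩), `--supports stmt-QuantumFields-24197`.  THEOREMS ONLY, standard axioms, 0 `sorry`.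
References: [cite: Chatterjee2026YMHiggs, Lemma 5.1 / Cor. 5.2]; [folklore] (Archimedes' hat-box theorem).
-/

set_option autoImplicit false

noncomputable section

open MeasureTheory Quaternion Set Real
open scoped Quaternion ENNReal BigOperators
open Literature.MathematicalPhysics.QuantumLattice
open Literature.MathematicalPhysics.QuantumFieldTheory (haarProbability)
open Literature.MathematicalPhysics.QuantumFieldTheory.Balaban1983to89.T4HaarSU2Translate (su2Quat_quatToSU2 measurable_su2Quat
  continuous_su2Quat)
open Summit.QuantumFields.YangMills.Theorems.SwapTwistDeficit.ToronLog

attribute [local instance] Literature.Analysis.FluidPDE.Tao2016.quatMeasurableSpace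
  Literature.Analysis.FluidPDE.Tao2016.quatBorelSpace
  Literature.MathematicalPhysics.QuantumLattice.secondCountableTopology_su2

namespace Summit.QuantumFields.YangMills.Theorems.SwapVirialDeficit.ZeroModeExact

/-! ## §1 The radial integral `∫₀^ρ r·(c+r²)⁻² dr = ½(c⁻¹ − (c+ρ²)⁻¹)` -/

/-- `d/dr [−½ (c + r²)⁻¹] = r·((c + r²)⁻¹)²` (`c > 0`). [folklore] -/
theorem hasDerivAt_radial {c : ℝ} (hc : 0 < c) (r : ℝ) :
    HasDerivAt (fun x : ℝ => -(1 / 2 : ℝ) * (c + x ^ 2)⁻¹) (r * ((c + r ^ 2)⁻¹) ^ 2) r := by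
  have hne : c + r ^ 2 ≠ 0 := by positivity
  have h1 : HasDerivAt (fun x : ℝ => c + x ^ 2) (2 * r) r := by
    simpa using (hasDerivAt_pow 2 r).const_add c
  have h2 := (h1.inv hne).const_mul (-(1 / 2 : ℝ))
  refine h2.congr_deriv ?_
  rw [inv_pow, div_eq_mul_inv]
  ring

/-- `∫₀^ρ r·((c+r²)⁻¹)² dr = ½·(c⁻¹ − (c+ρ²)⁻¹)` (`c > 0`). [folklore] -/
theorem integral_radial {c : ℝ} (hc : 0 < c) (ρ : ℝ) :
    ∫ r in (0 : ℝ)..ρ, r * ((c + r ^ 2)⁻¹) ^ 2 = (1 / 2 : ℝ) * (c⁻¹ - (c + ρ ^ 2)⁻¹) := by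
  have hcont : Continuous fun r : ℝ => r * ((c + r ^ 2)⁻¹) ^ 2 := by
    refine continuous_id.mul ((Continuous.inv₀ (by fun_prop) fun x => ?_).pow 2)
    positivity
  rw [intervalIntegral.integral_eq_sub_of_hasDerivAt (fun x _ => hasDerivAt_radial hc x) (hcont.intervalIntegrable _ _)]
  norm_num
  ring

/-- Lower-integral form on `(0, ∞)` with the cut-off `r² ≤ S`: `∫_{r>0} 𝟙{r² ≤ S}·r·(c+r²)⁻² = ½(c⁻¹ − (c+S)⁻¹)` (`c > 0`, `S ≥ 0`). [folklore] -/
theorem lintegral_radial_cutoff {c S : ℝ} (hc : 0 < c) (hS : 0 ≤ S) :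
    ∫⁻ r in Ioi (0 : ℝ), ENNReal.ofReal (r * ((Set.Iic S).indicator (fun p : ℝ => ((c + p)⁻¹) ^ 2) (r ^ 2))) =
      ENNReal.ofReal ((1 / 2 : ℝ) * (c⁻¹ - (c + S)⁻¹)) := by
  have hsqrt : Real.sqrt S ^ 2 = S := Real.sq_sqrt hS
  -- the integrand vanishes beyond `√S` and equals `r (c+r²)⁻²` on `(0, √S]`
  have hsplit : ∫⁻ r in Ioi (0 : ℝ), ENNReal.ofReal (r * ((Set.Iic S).indicator (fun p : ℝ => ((c + p)⁻¹) ^ 2) (r ^ 2))) =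
      ∫⁻ r in Ioc (0 : ℝ) (Real.sqrt S), ENNReal.ofReal (r * ((c + r ^ 2)⁻¹) ^ 2) := by
    rw [← lintegral_indicator measurableSet_Ioc, ← lintegral_indicator measurableSet_Ioi]
    refine lintegral_congr fun r => ?_
    by_cases h1 : r ∈ Ioi (0 : ℝ)
    · rw [indicator_of_mem h1]
      have h1' : 0 < r := h1
      by_cases h2 : r ≤ Real.sqrt S
      · rw [indicator_of_mem (show r ∈ Ioc (0 : ℝ) (Real.sqrt S) from ⟨h1', h2⟩), indicator_of_mem]
        rw [Set.mem_Iic]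
        calc r ^ 2 ≤ Real.sqrt S ^ 2 := pow_le_pow_left₀ h1'.le h2 2
          _ = S := hsqrt
      · rw [indicator_of_notMem (fun h : r ∈ Ioc (0 : ℝ) (Real.sqrt S) => h2 h.2), indicator_of_notMem, mul_zero,
          ENNReal.ofReal_zero]
        rw [Set.mem_Iic]; intro h3; apply h2
        rw [← Real.sqrt_sq h1'.le]; exact Real.sqrt_le_sqrt h3
    · rw [indicator_of_notMem h1, indicator_of_notMem (fun h : r ∈ Ioc (0 : ℝ) (Real.sqrt S) => h1 h.1)]
  rw [hsplit]
  have hcont : Continuous fun r : ℝ => r * ((c + r ^ 2)⁻¹) ^ 2 := by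
    refine continuous_id.mul ((Continuous.inv₀ (by fun_prop) fun x => ?_).pow 2)
    positivity
  rw [← ofReal_integral_eq_lintegral_ofReal (hcont.integrableOn_Icc.mono_set Ioc_subset_Icc_self)]
  · rw [← intervalIntegral.integral_of_le (Real.sqrt_nonneg S), integral_radial hc (Real.sqrt S), hsqrt]
  · exact (ae_restrict_iff' measurableSet_Ioc).2 (Filter.Eventually.of_forall fun r hr => by
      have := hr.1; positivity)

/-! ## §2 The disc integral `∫_{|w|² ≤ S} (c+|w|²)⁻² dw = π(c⁻¹ − (c+S)⁻¹)` by polar coordinates -/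

/-- ★ The disc integral on `ℝ × ℝ`: `∫ 𝟙{w₁²+w₂² ≤ S}·((c + w₁² + w₂²)⁻¹)² dw = π·(c⁻¹ − (c+S)⁻¹)` (`c > 0`, `S ≥ 0`). [folklore] -/
theorem lintegral_disc {c S : ℝ} (hc : 0 < c) (hS : 0 ≤ S) :
    ∫⁻ w : ℝ × ℝ, ENNReal.ofReal ((Set.Iic S).indicator (fun p : ℝ => ((c + p)⁻¹) ^ 2) (w.1 ^ 2 + w.2 ^ 2)) =
      ENNReal.ofReal (Real.pi * (c⁻¹ - (c + S)⁻¹)) := by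
  set g : ℝ → ℝ := (Set.Iic S).indicator (fun p : ℝ => ((c + p)⁻¹) ^ 2) with hg
  have hg0 : ∀ p, 0 ≤ g p := fun p => by
    rw [hg]; by_cases hp : p ∈ Set.Iic S
    · rw [indicator_of_mem hp]; positivity
    · rw [indicator_of_notMem hp]
  have hgm : Measurable g := (((measurable_const.add measurable_id).inv).pow_const 2).indicator measurableSet_Iic
  rw [← lintegral_comp_polarCoord_symm]
  have hpol : ∀ p : ℝ × ℝ, (polarCoord.symm p).1 ^ 2 + (polarCoord.symm p).2 ^ 2 = p.1 ^ 2 := by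
    intro p
    simp only [polarCoord_symm_apply]
    nlinarith [Real.cos_sq_add_sin_sq p.2]
  simp only [hpol, smul_eq_mul]
  rw [show polarCoord.target = Ioi (0 : ℝ) ×ˢ Ioo (-Real.pi) Real.pi from rfl, Measure.volume_eq_prod, ← Measure.prod_restrict]
  have hsub : 0 ≤ (1 / 2 : ℝ) * (c⁻¹ - (c + S)⁻¹) :=
    mul_nonneg (by norm_num) (sub_nonneg.2 (inv_anti₀ hc (le_add_of_nonneg_right hS)))
  have hf1 : Measurable fun r : ℝ => ENNReal.ofReal (r * g (r ^ 2)) :=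
    ENNReal.measurable_ofReal.comp (measurable_id.mul (hgm.comp (measurable_id.pow_const 2)))
  rw [show (fun p : ℝ × ℝ => ENNReal.ofReal p.1 * ENNReal.ofReal (g (p.1 ^ 2))) =
      fun p : ℝ × ℝ => (fun r : ℝ => ENNReal.ofReal (r * g (r ^ 2))) p.1 * (fun _ : ℝ => (1 : ℝ≥0∞)) p.2 from by
        funext p
        show _ = ENNReal.ofReal (p.1 * g (p.1 ^ 2)) * 1
        rw [mul_one, ENNReal.ofReal_mul' (hg0 _)],
    lintegral_prod_mul hf1.aemeasurable measurable_const.aemeasurable, lintegral_const, Measure.restrict_apply MeasurableSet.univ,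
    univ_inter, Real.volume_Ioo, one_mul, hg, lintegral_radial_cutoff hc hS, ← ENNReal.ofReal_mul hsub]
  congr 1
  rw [show Real.pi - -Real.pi = 2 * Real.pi by ring]
  ring

/-- The disc integral transported to `Fin 2 → ℝ`. [folklore] -/
theorem lintegral_disc_fin {c S : ℝ} (hc : 0 < c) (hS : 0 ≤ S) :
    ∫⁻ w : Fin 2 → ℝ, ENNReal.ofReal ((Set.Iic S).indicator (fun p : ℝ => ((c + p)⁻¹) ^ 2) (w 0 ^ 2 + w 1 ^ 2)) =
      ENNReal.ofReal (Real.pi * (c⁻¹ - (c + S)⁻¹)) := by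
  have h := volume_preserving_finTwoArrow ℝ
  have hm : Measurable fun w : ℝ × ℝ =>
      ENNReal.ofReal ((Set.Iic S).indicator (fun p : ℝ => ((c + p)⁻¹) ^ 2) (w.1 ^ 2 + w.2 ^ 2)) :=
    ENNReal.measurable_ofReal.comp (((((measurable_const.add measurable_id).inv).pow_const 2).indicator
      measurableSet_Iic).comp (by fun_prop))
  rw [← lintegral_disc hc hS, ← h.lintegral_comp hm]
  rfl

/-! ## §3 The tube in the gnomonic chart -/

/-- The axial `(J,K)`-tube of radius `R`: unit quaternions with `q_J² + q_K² ≤ R²`. -/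
theorem measurableSet_tube (R : ℝ) :
    MeasurableSet {u : Matrix.specialUnitaryGroup (Fin 2) ℂ | (su2Quat u).imJ ^ 2 + (su2Quat u).imK ^ 2 ≤ R ^ 2} := by
  refine measurableSet_le ?_ measurable_const
  exact ((Quaternion.continuous_imJ.comp continuous_su2Quat).pow 2 |>.add
    ((Quaternion.continuous_imK.comp continuous_su2Quat).pow 2)).measurable

/-- In the chart: for `x ≠ 0`, `q(P x)_J² + q(P x)_K² = (x_J² + x_K²)/‖x‖²`. [folklore] -/
theorem tube_coord {x : ℍ} (hx : x ≠ 0) :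
    (su2Quat (quatToSU2 x)).imJ ^ 2 + (su2Quat (quatToSU2 x)).imK ^ 2 = (x.imJ ^ 2 + x.imK ^ 2) / ‖x‖ ^ 2 := by
  rw [su2Quat_quatToSU2 hx, Quaternion.imJ_smul, Quaternion.imK_smul, smul_eq_mul, smul_eq_mul]
  have : ‖x‖ ≠ 0 := norm_ne_zero_iff.2 hx
  field_simp

/-- Membership of the two chart points `P(±(1,v))` in the tube: both iff `v₁² + v₂² ≤ R²(1 + Σ vᵢ²)`. [folklore] -/
theorem gnomonic_mem_tube_iff (R : ℝ) (v : Fin 3 → ℝ) (s : Bool) :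
    (quatToSU2 (if s then gnomonicQuat v else -gnomonicQuat v)) ∈
        {u : Matrix.specialUnitaryGroup (Fin 2) ℂ | (su2Quat u).imJ ^ 2 + (su2Quat u).imK ^ 2 ≤ R ^ 2} ↔
      v 1 ^ 2 + v 2 ^ 2 ≤ R ^ 2 * (1 + ∑ i, v i ^ 2) := by
  have hx : (if s then gnomonicQuat v else -gnomonicQuat v) ≠ 0 := by
    cases s
    · simpa using neg_ne_zero.2 (gnomonicQuat_ne_zero v)
    · simpa using gnomonicQuat_ne_zero v
  have hn : ‖(if s then gnomonicQuat v else -gnomonicQuat v)‖ ^ 2 = 1 + ∑ i, v i ^ 2 := by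
    cases s
    · simp only [Bool.false_eq_true, ↓reduceIte, norm_neg]; exact sq_norm_gnomonicQuat v
    · simp only [↓reduceIte]; exact sq_norm_gnomonicQuat v
  have hJK : (if s then gnomonicQuat v else -gnomonicQuat v).imJ ^ 2 + (if s then gnomonicQuat v else -gnomonicQuat v).imK ^ 2
      = v 1 ^ 2 + v 2 ^ 2 := by
    cases s <;> simp [gnomonicQuat]
  have hpos : 0 < 1 + ∑ i, v i ^ 2 := by positivity
  rw [Set.mem_setOf_eq, tube_coord hx, hn, hJK, div_le_iff₀ hpos]

/-- The chart integrand of the tube (indicator × gnomonic density). [folklore] -/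
theorem measurable_chartIntegrand (R : ℝ) :
    Measurable fun v : Fin 3 → ℝ => ({v : Fin 3 → ℝ | v 1 ^ 2 + v 2 ^ 2 ≤ R ^ 2 * (1 + ∑ i, v i ^ 2)}).indicator
      (fun v => ENNReal.ofReal (((1 + ∑ i, v i ^ 2)⁻¹) ^ 2)) v := by
  refine Measurable.indicator (ENNReal.measurable_ofReal.comp (by fun_prop)) ?_
  exact measurableSet_le (by fun_prop) (by fun_prop)

/-- ★ THE CHART INTEGRAL (`0 ≤ R < 1`): `∫_{ℝ³} 𝟙{v₁²+v₂² ≤ R²(1+|v|²)}·(1+|v|²)⁻² dv = π²R²`. [folklore] -/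
theorem lintegral_chart_tube {R : ℝ} (hR : 0 ≤ R) (hR1 : R < 1) :
    ∫⁻ v : Fin 3 → ℝ, ({v : Fin 3 → ℝ | v 1 ^ 2 + v 2 ^ 2 ≤ R ^ 2 * (1 + ∑ i, v i ^ 2)}).indicator
        (fun v => ENNReal.ofReal (((1 + ∑ i, v i ^ 2)⁻¹) ^ 2)) v = ENNReal.ofReal (Real.pi ^ 2 * R ^ 2) := by
  have h1R : 0 < 1 - R ^ 2 := by nlinarith
  -- split off the axial coordinate `v 0 = t`
  have hp := (volume_preserving_piFinSuccAbove (fun _ : Fin 3 => ℝ) 0).symm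
  rw [← hp.lintegral_comp (measurable_chartIntegrand R), Measure.volume_eq_prod, lintegral_prod]
  swap
  · exact ((measurable_chartIntegrand R).comp (MeasurableEquiv.measurable _)).aemeasurable
  -- identify the inner integrand for fixed `t`
  have hin : ∀ (t : ℝ) (w : Fin 2 → ℝ),
      ({v : Fin 3 → ℝ | v 1 ^ 2 + v 2 ^ 2 ≤ R ^ 2 * (1 + ∑ i, v i ^ 2)}).indicator
        (fun v => ENNReal.ofReal (((1 + ∑ i, v i ^ 2)⁻¹) ^ 2))
        ((MeasurableEquiv.piFinSuccAbove (fun _ : Fin 3 => ℝ) 0).symm (t, w)) =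
      ENNReal.ofReal ((Set.Iic (R ^ 2 * (1 + t ^ 2) / (1 - R ^ 2))).indicator (fun p : ℝ => (((1 + t ^ 2) + p)⁻¹) ^ 2)
        (w 0 ^ 2 + w 1 ^ 2)) := by
    intro t w
    have hcons : ((MeasurableEquiv.piFinSuccAbove (fun _ : Fin 3 => ℝ) 0).symm (t, w)) = Fin.cons t w := by
      rw [MeasurableEquiv.piFinSuccAbove_symm_apply]; exact Fin.insertNth_zero' t w
    rw [hcons]
    have hsum : ∑ i : Fin 3, (Fin.cons t w : Fin 3 → ℝ) i ^ 2 = t ^ 2 + (w 0 ^ 2 + w 1 ^ 2) := by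
      rw [Fin.sum_univ_three]
      rw [show (1 : Fin 3) = Fin.succ (0 : Fin 2) from rfl, show (2 : Fin 3) = Fin.succ (1 : Fin 2) from rfl,
        Fin.cons_zero, Fin.cons_succ, Fin.cons_succ]
      ring
    have h1 : (Fin.cons t w : Fin 3 → ℝ) 1 = w 0 := by
      rw [show (1 : Fin 3) = Fin.succ (0 : Fin 2) from rfl, Fin.cons_succ]
    have h2 : (Fin.cons t w : Fin 3 → ℝ) 2 = w 1 := by
      rw [show (2 : Fin 3) = Fin.succ (1 : Fin 2) from rfl, Fin.cons_succ]
    have hiff : (Fin.cons t w : Fin 3 → ℝ) ∈ {v : Fin 3 → ℝ | v 1 ^ 2 + v 2 ^ 2 ≤ R ^ 2 * (1 + ∑ i, v i ^ 2)} ↔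
        w 0 ^ 2 + w 1 ^ 2 ∈ Set.Iic (R ^ 2 * (1 + t ^ 2) / (1 - R ^ 2)) := by
      rw [Set.mem_setOf_eq, h1, h2, hsum, Set.mem_Iic, le_div_iff₀ h1R]
      constructor
      · intro h; nlinarith
      · intro h; nlinarith
    by_cases hmem : (Fin.cons t w : Fin 3 → ℝ) ∈ {v : Fin 3 → ℝ | v 1 ^ 2 + v 2 ^ 2 ≤ R ^ 2 * (1 + ∑ i, v i ^ 2)}
    · rw [indicator_of_mem hmem, indicator_of_mem (hiff.1 hmem), hsum, add_assoc]
    · rw [indicator_of_notMem hmem, indicator_of_notMem (fun h => hmem (hiff.2 h)), ENNReal.ofReal_zero]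
  simp_rw [hin]
  -- inner disc integral `= π R²/(1+t²)`
  have hdisc : ∀ t : ℝ, ∫⁻ w : Fin 2 → ℝ, ENNReal.ofReal ((Set.Iic (R ^ 2 * (1 + t ^ 2) / (1 - R ^ 2))).indicator
      (fun p : ℝ => (((1 + t ^ 2) + p)⁻¹) ^ 2) (w 0 ^ 2 + w 1 ^ 2)) = ENNReal.ofReal (Real.pi * R ^ 2 * (1 + t ^ 2)⁻¹) := by
    intro t
    have hc : 0 < 1 + t ^ 2 := by positivity
    rw [lintegral_disc_fin hc (by positivity)]
    congr 1
    field_simp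
    ring
  simp_rw [hdisc]
  -- outer integral `∫ (1+t²)⁻¹ dt = π`
  have hm : Measurable fun t : ℝ => ENNReal.ofReal ((1 + t ^ 2)⁻¹) := ENNReal.measurable_ofReal.comp (by fun_prop)
  simp_rw [ENNReal.ofReal_mul (by positivity : 0 ≤ Real.pi * R ^ 2)]
  rw [lintegral_const_mul _ hm, ← ofReal_integral_eq_lintegral_ofReal integrable_inv_one_add_sq
    (Filter.Eventually.of_forall fun t => by positivity), integral_univ_inv_one_add_sq, ← ENNReal.ofReal_mul (by positivity)]
  congr 1; ring

/-! ## §4 ★★ The axial tube has Haar mass `min 1 R²` -/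

/-- ★★ **ARCHIMEDES ON `S³`**: `Haar{u ∈ SU(2) | (q u)_J² + (q u)_K² ≤ R²} = min 1 R²` for `0 ≤ R` (as an extended real). [folklore] -/
theorem haar_axialTube_eq_ofReal {R : ℝ} (hR : 0 ≤ R) :
    haarProbability (Matrix.specialUnitaryGroup (Fin 2) ℂ)
        {u : Matrix.specialUnitaryGroup (Fin 2) ℂ | (su2Quat u).imJ ^ 2 + (su2Quat u).imK ^ 2 ≤ R ^ 2} =
      ENNReal.ofReal (min 1 (R ^ 2)) := by
  set T := {u : Matrix.specialUnitaryGroup (Fin 2) ℂ | (su2Quat u).imJ ^ 2 + (su2Quat u).imK ^ 2 ≤ R ^ 2} with hT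
  by_cases hR1 : 1 ≤ R
  · -- the tube is everything
    have hall : T = Set.univ := by
      rw [hT]; refine Set.eq_univ_of_forall fun u => ?_
      rw [Set.mem_setOf_eq]
      have h1 : (su2Quat u).re ^ 2 + (su2Quat u).imI ^ 2 + (su2Quat u).imJ ^ 2 + (su2Quat u).imK ^ 2 = 1 := by
        have h := norm_su2Quat u
        rw [← Quaternion.normSq_def', Quaternion.normSq_eq_norm_mul_self, h, mul_one]
      nlinarith [sq_nonneg (su2Quat u).re, sq_nonneg (su2Quat u).imI]
    rw [hall, measure_univ, min_eq_left (by nlinarith), ENNReal.ofReal_one]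
  · push Not at hR1
    rw [min_eq_right (by nlinarith)]
    have hmeas : Measurable (T.indicator (1 : Matrix.specialUnitaryGroup (Fin 2) ℂ → ℝ≥0∞)) :=
      measurable_one.indicator (measurableSet_tube R)
    rw [← lintegral_indicator_one (measurableSet_tube R), lintegral_haarProbability_su2_gnomonic _ hmeas]
    -- both chart points have the same indicator, the chart integrand of §3
    have hpt : ∀ v : Fin 3 → ℝ, (T.indicator (1 : Matrix.specialUnitaryGroup (Fin 2) ℂ → ℝ≥0∞) (quatToSU2 (gnomonicQuat v)) +
        T.indicator (1 : Matrix.specialUnitaryGroup (Fin 2) ℂ → ℝ≥0∞) (quatToSU2 (-gnomonicQuat v))) *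
        ENNReal.ofReal (((1 + ∑ i, v i ^ 2)⁻¹) ^ 2) =
        2 * ({v : Fin 3 → ℝ | v 1 ^ 2 + v 2 ^ 2 ≤ R ^ 2 * (1 + ∑ i, v i ^ 2)}).indicator
          (fun v => ENNReal.ofReal (((1 + ∑ i, v i ^ 2)⁻¹) ^ 2)) v := by
      intro v
      have hp := gnomonic_mem_tube_iff R v true
      have hm := gnomonic_mem_tube_iff R v false
      simp only [↓reduceIte, Bool.false_eq_true] at hp hm
      by_cases hv : v 1 ^ 2 + v 2 ^ 2 ≤ R ^ 2 * (1 + ∑ i, v i ^ 2)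
      · rw [indicator_of_mem (hp.2 hv), indicator_of_mem (hm.2 hv),
          indicator_of_mem (show v ∈ {v : Fin 3 → ℝ | v 1 ^ 2 + v 2 ^ 2 ≤ R ^ 2 * (1 + ∑ i, v i ^ 2)} from hv), Pi.one_apply,
          Pi.one_apply]
        ring
      · rw [indicator_of_notMem (fun h => hv (hp.1 h)), indicator_of_notMem (fun h => hv (hm.1 h)),
          indicator_of_notMem (show v ∉ {v : Fin 3 → ℝ | v 1 ^ 2 + v 2 ^ 2 ≤ R ^ 2 * (1 + ∑ i, v i ^ 2)} from hv)]
        simp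
    simp_rw [hpt]
    rw [lintegral_const_mul _ (measurable_chartIntegrand R), lintegral_chart_tube hR hR1, show (2 : ℝ≥0∞) = ENNReal.ofReal 2 by simp,
      ← ENNReal.ofReal_mul (by norm_num), ← ENNReal.ofReal_mul (by positivity)]
    congr 1
    field_simp

/-- ★★ **ARCHIMEDES ON `S³`, real form**: `Haar.real{u ∈ SU(2) | (q u)_J² + (q u)_K² ≤ R²} = min 1 R²` (`0 ≤ R`). [folklore] -/
theorem haar_axialTube_eq {R : ℝ} (hR : 0 ≤ R) :
    (haarProbability (Matrix.specialUnitaryGroup (Fin 2) ℂ)).real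
        {u : Matrix.specialUnitaryGroup (Fin 2) ℂ | (su2Quat u).imJ ^ 2 + (su2Quat u).imK ^ 2 ≤ R ^ 2} = min 1 (R ^ 2) := by
  rw [measureReal_def, haar_axialTube_eq_ofReal hR, ENNReal.toReal_ofReal (le_min zero_le_one (sq_nonneg R))]

end Summit.QuantumFields.YangMills.Theorems.SwapVirialDeficit.ZeroModeExact

end
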